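import Literature.InformationTheory.QuantumCodes.HypergraphProductThresholds
import Literature.InformationTheory.QuantumCodes.CSSMixedChannelThreshold
import Literature.InformationTheory.QuantumCodes.GoodQLDPCLemmas
import HarnessLib

/-!
# A certified code-capacity threshold for ALL `w`-limited quantum LDPC codes of linear distance
# (uniform Dumer–Kovalev–Pryadko bound in the `IsQLDPCCodeWith` vocabulary)

Topic `Literature/InformationTheory/QuantumCodes` (venture QEC, LADDER-QEC rung Q5 × the good-qLDPC facts of
`GoodQLDPC.lean`; qec-lit-2 gen 3). PROVED, no named fact, kernel axioms. The tree types the existence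
theorems of asymptotically good quantum LDPC codes (Panteleev–Kalachev, Leverrier–Zémor,
Dinur–Hsieh–Lin–Vidick) through the parameter predicate `IsQLDPCCodeWith H_X H_Z w K D` ("`w`-limited CSS
pair with `k ≥ K`, `d ≥ D`") and families `IsQLDPCFamily F w R δ`. Dumer–Kovalev–Pryadko's Theorem 2 says
precisely that such families — bounded check weight, distance growing at least logarithmically — have a
positive erasure / code-capacity threshold under minimum-weight decoding. This file proves it in that
vocabulary, over `𝔽₂`, one error type (the `Z`-errors, detected by `H_X`, trivial iff in `rs H_Z`):

* `IsQLDPCCodeWith.zFailureProb_le` — FINITE SIZE: for every `w`-limited pair (`w ≥ 2`) with `D ≥ 1`, every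
  minimum-weight decoder and `0 ≤ p ≤ 1/2` with `r = 2(w-1)√(p(1-p)) < 1`:
  `P_fail ≤ n · r^{⌈D⌉} / ((w-1)(1-r))`.
* `qldpc_uniform_codeCapacityThreshold` — UNIFORM THRESHOLD: for `w ≥ 2`, `δ > 0` and every rate with
  `4(w-1)² p(1-p) < 1` (i.e. `p < p₀(w-1)`), for every `ε > 0` there is `N` such that EVERY `w`-limited CSS
  pair of ANY length `n ≥ N` with `d ≥ δ n`, decoded by ANY minimum-weight decoder, has `P_fail ≤ ε`.
  In particular every member of length `≥ N` of every family witnessing `IsQLDPCFamily 𝔽₂ w R δ` —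
  hence of the Panteleev–Kalachev / quantum-Tanner / DHLV families once their named facts are granted — is
  protected below `p₀(w-1)`; no property of the family beyond (`w`, `δ`) is used.
* `IsQLDPCCodeWith.zErasureProb_le`, `qldpc_uniform_erasureThreshold` — the same for independent ERASURES of
  rate `y` with `(w-1) y < 1` (the abstract's "nonzero erasure threshold", here `≥ 1/(w-1)` uniformly).

## References

* [DumerKovalevPryadko2015] I. Dumer, A. A. Kovalev, L. P. Pryadko, PRL 115 (2015) 050502, Thm 2 and
  Abstract ("all families of quantum low-density parity-check codes with … distances growing at least
  logarithmically … have a nonzero erasure threshold").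
* [PanteleevKalachev2022] P. Panteleev, G. Kalachev, STOC 2022, §1 (`w`-limited CSS codes; `k`, `d`).
-/

namespace Literature.InformationTheory.QuantumCodes

open Finset Matrix Filter Topology

variable {RX RZ Q : Type*} [Fintype RX] [Fintype RZ] [Fintype Q] [DecidableEq Q]

open Classical in
/-- **Finite-size bound for every `w`-limited quantum LDPC code** (`Z`-errors, code capacity, every
minimum-weight decoder): `P_fail ≤ n · r^{⌈D⌉} / ((w-1)(1-r))`, `r = 2(w-1)√(p(1-p)) < 1`, `D ≥ 1`.
[cite: DumerKovalevPryadko2015, Thm 2 (y = 0) with eq. (upper-bound-Nm-CSS)] -/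
theorem IsQLDPCCodeWith.zFailureProb_le {HX : Matrix RX Q (ZMod 2)} {HZ : Matrix RZ Q (ZMod 2)} {w : ℕ}
    {K D : ℝ} (h : IsQLDPCCodeWith HX HZ w K D) (hw : 2 ≤ w) (hD : 1 ≤ D)
    {Dec : Decoder (RX → ZMod 2) (Q → ZMod 2)}
    (hDec : Dec.IsMinWeight (fun e => HX *ᵥ e) {x | HX *ᵥ x = 0} hammingNorm)
    {p : ℝ} (hp0 : 0 ≤ p) (hp : p ≤ 1 / 2) (hr : 2 * ((w - 1 : ℕ) : ℝ) * Real.sqrt (p * (1 - p)) < 1) :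
    ∑ e ∈ univ.filter (fun e : Q → ZMod 2 =>
        ¬ Dec.Corrects (fun e => HX *ᵥ e) (rowSpace HZ : Set (Q → ZMod 2)) e), bernoulliWeight p (supp e) ≤
      (Fintype.card Q : ℝ) * (2 * ((w - 1 : ℕ) : ℝ) * Real.sqrt (p * (1 - p))) ^ ⌈D⌉₊ /
        (((w - 1 : ℕ) : ℝ) * (1 - 2 * ((w - 1 : ℕ) : ℝ) * Real.sqrt (p * (1 - p)))) := by
  have hrow : ∀ i, (rowSupp HX i).card ≤ w := fun i => by
    rw [card_rowSupp_eq_hammingNorm]; exact h.rowX_le i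
  have hd1 : 1 ≤ ⌈D⌉₊ := Nat.one_le_iff_ne_zero.2 (Nat.pos_iff_ne_zero.1 (Nat.ceil_pos.2 (by linarith)))
  have hd : ∀ x : Q → ZMod 2, HX *ᵥ x = 0 → x ∉ rowSpace HZ → ⌈D⌉₊ ≤ hammingNorm x :=
    fun x hx hxS => Nat.ceil_le.2 (h.le_hammingNorm (Or.inl ⟨hx, hxS⟩))
  exact sum_not_corrects_bernoulli_le_of_rowWeight HX (rowSpace HZ) hDec hw hrow hd1 hd hp0 hp hr

/-- The tail `m · r^m / c` is eventually small (`0 ≤ r < 1`). [cite: DennisEtAl2002, §5.3 (geometric tail)] -/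
private theorem exists_forall_ge_mul_pow_le {r : ℝ} (c : ℝ) (hr0 : 0 ≤ r) (hr1 : r < 1) {ε : ℝ}
    (hε : 0 < ε) : ∃ M : ℕ, ∀ m : ℕ, M ≤ m → (m : ℝ) * r ^ m / c ≤ ε := by
  have h := tendsto_self_mul_const_pow_of_abs_lt_one (show |r| < 1 by rwa [abs_of_nonneg hr0])
  have h' := h.div_const c
  rw [zero_div] at h'
  have hev := (h'.eventually (gt_mem_nhds hε))
  obtain ⟨M, hM⟩ := eventually_atTop.1 hev
  exact ⟨M, fun m hm => (hM m hm).le⟩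

open Classical in
/-- **Uniform code-capacity threshold for `w`-limited quantum LDPC codes of relative distance `≥ δ`**
(DKP15 Theorem 2 for the whole class at once): given `w ≥ 2`, `δ > 0` and a rate `0 ≤ p ≤ 1/2` with
`4(w-1)² p(1-p) < 1`, for every `ε > 0` there is `N` such that every `w`-limited CSS pair over `𝔽₂` of any
length `n ≥ N` with `D ≥ δ n` — every member of every `IsQLDPCFamily 𝔽₂ w R δ`, in particular —, decoded by
ANY minimum-weight decoder, has `Z`-failure probability `≤ ε`.
[cite: DumerKovalevPryadko2015, Thm 2 and Abstract (all bounded-weight families with growing distance have a nonzero threshold)] -/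
theorem qldpc_uniform_codeCapacityThreshold {w : ℕ} (hw : 2 ≤ w) {δ : ℝ} (hδ : 0 < δ)
    {p : ℝ} (hp0 : 0 ≤ p) (hp : p ≤ 1 / 2) (h4 : 4 * ((w - 1 : ℕ) : ℝ) ^ 2 * (p * (1 - p)) < 1)
    {ε : ℝ} (hε : 0 < ε) :
    ∃ N : ℕ, ∀ (mX mZ n : ℕ) (HX : Matrix (Fin mX) (Fin n) (ZMod 2)) (HZ : Matrix (Fin mZ) (Fin n) (ZMod 2))
      (K D : ℝ), IsQLDPCCodeWith HX HZ w K D → N ≤ n → δ * n ≤ D →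
      ∀ (Dec : Decoder (Fin mX → ZMod 2) (Fin n → ZMod 2)),
        Dec.IsMinWeight (fun e => HX *ᵥ e) {x | HX *ᵥ x = 0} hammingNorm →
        ∑ e ∈ univ.filter (fun e : Fin n → ZMod 2 =>
            ¬ Dec.Corrects (fun e => HX *ᵥ e) (rowSpace HZ : Set (Fin n → ZMod 2)) e),
            bernoulliWeight p (supp e) ≤ ε := by
  set Kw : ℝ := ((w - 1 : ℕ) : ℝ) with hKw
  have hK1 : 1 ≤ Kw := by
    rw [hKw]
    exact_mod_cast (show 1 ≤ w - 1 by omega)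
  have hK0 : 0 < Kw := by linarith
  set s : ℝ := Real.sqrt (p * (1 - p)) with hs
  have hs0 : 0 ≤ s := Real.sqrt_nonneg _
  have hpp : 0 ≤ p * (1 - p) := mul_nonneg hp0 (by linarith)
  set r : ℝ := 2 * Kw * s with hrdef
  have hr0 : 0 ≤ r := by positivity
  have hr1 : r < 1 := by
    have hsq : r ^ 2 = 4 * Kw ^ 2 * (p * (1 - p)) := by
      rw [hrdef, mul_pow, mul_pow, hs, Real.sq_sqrt hpp]
      ring
    have h : r ^ 2 < 1 := by rw [hsq]; exact h4
    have := (sq_lt_one_iff_abs_lt_one r).1 h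
    rwa [abs_of_nonneg hr0] at this
  have h1r : 0 < 1 - r := by linarith
  -- the tail constant: `P_fail ≤ n r^⌈D⌉ / (Kw (1-r)) ≤ (⌈D⌉/δ) r^⌈D⌉ / (Kw (1-r))`
  have hc : 0 < δ * (Kw * (1 - r)) := by positivity
  obtain ⟨M, hM⟩ := exists_forall_ge_mul_pow_le (δ * (Kw * (1 - r))) hr0 hr1 hε
  -- choose `N` with `δ N ≥ max M 1`
  obtain ⟨N, hN⟩ := exists_nat_ge ((max (M : ℝ) 1) / δ)
  refine ⟨N, fun mX mZ n HX HZ K D hcode hn hDn Dec hDec => ?_⟩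
  have hδn : max (M : ℝ) 1 ≤ δ * n := by
    have h1 : (max (M : ℝ) 1) / δ ≤ n := hN.trans (by exact_mod_cast hn)
    rwa [div_le_iff₀ hδ, mul_comm] at h1
  have hD1 : 1 ≤ D := le_trans (le_trans (le_max_right _ _) hδn) hDn
  have hDM : (M : ℝ) ≤ D := le_trans (le_trans (le_max_left _ _) hδn) hDn
  have hceil : M ≤ ⌈D⌉₊ := by
    have : (M : ℝ) ≤ ⌈D⌉₊ := hDM.trans (Nat.le_ceil D)
    exact_mod_cast this
  have hfin := hcode.zFailureProb_le hw hD1 hDec hp0 hp (by rw [← hKw, ← hs]; exact hr1)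
  rw [Fintype.card_fin, ← hKw, ← hs] at hfin
  refine hfin.trans ?_
  -- `n ≤ D/δ ≤ ⌈D⌉/δ`
  have hnD : (n : ℝ) ≤ ⌈D⌉₊ / δ := by
    rw [le_div_iff₀ hδ, mul_comm]
    exact hDn.trans (Nat.le_ceil D)
  have hrm : 0 ≤ r ^ ⌈D⌉₊ := pow_nonneg hr0 _
  have hstep : (n : ℝ) * r ^ ⌈D⌉₊ / (Kw * (1 - r)) ≤ (⌈D⌉₊ : ℝ) * r ^ ⌈D⌉₊ / (δ * (Kw * (1 - r))) := by
    rw [div_le_div_iff₀ (by positivity) hc]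
    have : (n : ℝ) * (δ * (Kw * (1 - r))) ≤ (⌈D⌉₊ : ℝ) * (Kw * (1 - r)) := by
      have h1 : (n : ℝ) * δ ≤ ⌈D⌉₊ := by
        have := hnD
        rwa [le_div_iff₀ hδ] at this
      nlinarith
    nlinarith
  have hfold : (2 * Kw * s) = r := rfl
  rw [hfold]
  exact hstep.trans (hM _ hceil)

/-- **Finite-size ERASURE bound for every `w`-limited quantum LDPC code** (`Z`-sector): the probability
that an independent erasure pattern of rate `y` is uncorrectable is `≤ n ((w-1)y)^{⌈D⌉} / ((w-1)(1-(w-1)y))`.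
[cite: DumerKovalevPryadko2015, Thm 2 (erasure part) with eq. (upper-bound-Nm-CSS)] -/
theorem IsQLDPCCodeWith.zErasureProb_le {HX : Matrix RX Q (ZMod 2)} {HZ : Matrix RZ Q (ZMod 2)} {w : ℕ}
    {K D : ℝ} (h : IsQLDPCCodeWith HX HZ w K D) (hw : 2 ≤ w) (hD : 1 ≤ D)
    {y : ℝ} (hy0 : 0 ≤ y) (hy1 : y ≤ 1) (hr : ((w - 1 : ℕ) : ℝ) * y < 1) :
    ErasureDecoder.uncorrectableProb {x : Q → ZMod 2 | HX *ᵥ x = 0} (rowSpace HZ : Set (Q → ZMod 2)) y ≤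
      (Fintype.card Q : ℝ) * (((w - 1 : ℕ) : ℝ) * y) ^ ⌈D⌉₊ /
        (((w - 1 : ℕ) : ℝ) * (1 - ((w - 1 : ℕ) : ℝ) * y)) := by
  have hrow : ∀ i, (rowSupp HX i).card ≤ w := fun i => by
    rw [card_rowSupp_eq_hammingNorm]; exact h.rowX_le i
  have hd1 : 1 ≤ ⌈D⌉₊ := Nat.one_le_iff_ne_zero.2 (Nat.pos_iff_ne_zero.1 (Nat.ceil_pos.2 (by linarith)))
  have hd : ∀ x : Q → ZMod 2, HX *ᵥ x = 0 → x ∉ rowSpace HZ → ⌈D⌉₊ ≤ hammingNorm x :=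
    fun x hx hxS => Nat.ceil_le.2 (h.le_hammingNorm (Or.inl ⟨hx, hxS⟩))
  exact uncorrectableProb_le HX (rowSpace HZ) hw hrow hd1 hd hy0 hy1 hr

/-- **Uniform ERASURE threshold `1/(w-1)` for `w`-limited quantum LDPC codes of relative distance `≥ δ`**
("all families of quantum LDPC codes with … distances growing at least logarithmically … have a nonzero
erasure threshold"): for `w ≥ 2`, `δ > 0` and `0 ≤ y` with `(w-1) y < 1`, for every `ε > 0` there is `N`
such that every `w`-limited CSS pair of length `n ≥ N` with `D ≥ δ n` has uncorrectable-erasure probability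
`≤ ε` (for this error type; by `ErasureDecoding.lean` this is the failure probability of every consistent
erasure decoder). [cite: DumerKovalevPryadko2015, Abstract and Thm 2 (erasure part)] -/
theorem qldpc_uniform_erasureThreshold {w : ℕ} (hw : 2 ≤ w) {δ : ℝ} (hδ : 0 < δ)
    {y : ℝ} (hy0 : 0 ≤ y) (hy : ((w - 1 : ℕ) : ℝ) * y < 1) {ε : ℝ} (hε : 0 < ε) :
    ∃ N : ℕ, ∀ (mX mZ n : ℕ) (HX : Matrix (Fin mX) (Fin n) (ZMod 2)) (HZ : Matrix (Fin mZ) (Fin n) (ZMod 2))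
      (K D : ℝ), IsQLDPCCodeWith HX HZ w K D → N ≤ n → δ * n ≤ D →
      ErasureDecoder.uncorrectableProb {x : Fin n → ZMod 2 | HX *ᵥ x = 0}
        (rowSpace HZ : Set (Fin n → ZMod 2)) y ≤ ε := by
  set Kw : ℝ := ((w - 1 : ℕ) : ℝ) with hKw
  have hK1 : 1 ≤ Kw := by
    rw [hKw]
    exact_mod_cast (show 1 ≤ w - 1 by omega)
  have hK0 : 0 < Kw := by linarith
  set r : ℝ := Kw * y with hrdef
  have hr0 : 0 ≤ r := by positivity
  have hr1 : r < 1 := hy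
  have h1r : 0 < 1 - r := by linarith
  have hy1 : y ≤ 1 := by nlinarith
  obtain ⟨M, hM⟩ := exists_forall_ge_mul_pow_le (δ * (Kw * (1 - r))) hr0 hr1 hε
  obtain ⟨N, hN⟩ := exists_nat_ge ((max (M : ℝ) 1) / δ)
  refine ⟨N, fun mX mZ n HX HZ K D hcode hn hDn => ?_⟩
  have hδn : max (M : ℝ) 1 ≤ δ * n := by
    have h1 : (max (M : ℝ) 1) / δ ≤ n := hN.trans (by exact_mod_cast hn)
    rwa [div_le_iff₀ hδ, mul_comm] at h1
  have hD1 : 1 ≤ D := le_trans (le_trans (le_max_right _ _) hδn) hDn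
  have hDM : (M : ℝ) ≤ D := le_trans (le_trans (le_max_left _ _) hδn) hDn
  have hceil : M ≤ ⌈D⌉₊ := by
    have : (M : ℝ) ≤ ⌈D⌉₊ := hDM.trans (Nat.le_ceil D)
    exact_mod_cast this
  have hfin := hcode.zErasureProb_le hw hD1 hy0 hy1 (by rw [← hKw]; exact hr1)
  rw [Fintype.card_fin, ← hKw] at hfin
  refine hfin.trans ?_
  have hnD : (n : ℝ) ≤ ⌈D⌉₊ / δ := by
    rw [le_div_iff₀ hδ, mul_comm]
    exact hDn.trans (Nat.le_ceil D)
  have hc : 0 < δ * (Kw * (1 - r)) := by positivity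
  have hrm : 0 ≤ r ^ ⌈D⌉₊ := pow_nonneg hr0 _
  have hstep : (n : ℝ) * r ^ ⌈D⌉₊ / (Kw * (1 - r)) ≤ (⌈D⌉₊ : ℝ) * r ^ ⌈D⌉₊ / (δ * (Kw * (1 - r))) := by
    rw [div_le_div_iff₀ (by positivity) hc]
    have : (n : ℝ) * (δ * (Kw * (1 - r))) ≤ (⌈D⌉₊ : ℝ) * (Kw * (1 - r)) := by
      have h1 : (n : ℝ) * δ ≤ ⌈D⌉₊ := by
        have := hnD
        rwa [le_div_iff₀ hδ] at this
      nlinarith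
    nlinarith
  have hfold : Kw * y = r := rfl
  rw [hfold]
  exact hstep.trans (hM _ hceil)

/-! ### Families: `IsQLDPCFamily` and the Panteleev–Kalachev fact -/

open Classical in
/-- **Every `w`-limited family with rate `≥ R` and relative distance `≥ δ > 0` is below threshold for
`p < p₀(w-1)`**: for every `ε > 0` and every `N₀` the family contains a code of length `n ≥ N₀` (with
`k ≥ Rn`, `d ≥ δn`) whose `Z`-failure probability under ANY minimum-weight decoder is `≤ ε` (the family
predicate only asserts existence of members of arbitrarily large length, so this is the sharpest form).
[cite: DumerKovalevPryadko2015, Abstract and Thm 2] -/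
theorem IsQLDPCFamily.exists_failureProb_le {w : ℕ} {R δ : ℝ} (hF : IsQLDPCFamily (ZMod 2) w R δ)
    (hw : 2 ≤ w) (hδ : 0 < δ) {p : ℝ} (hp0 : 0 ≤ p) (hp : p ≤ 1 / 2)
    (h4 : 4 * ((w - 1 : ℕ) : ℝ) ^ 2 * (p * (1 - p)) < 1) {ε : ℝ} (hε : 0 < ε) (N₀ : ℕ) :
    ∃ n : ℕ, N₀ ≤ n ∧ ∃ (mX mZ : ℕ) (HX : Matrix (Fin mX) (Fin n) (ZMod 2))
      (HZ : Matrix (Fin mZ) (Fin n) (ZMod 2)), IsQLDPCCodeWith HX HZ w (R * n) (δ * n) ∧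
      ∀ (Dec : Decoder (Fin mX → ZMod 2) (Fin n → ZMod 2)),
        Dec.IsMinWeight (fun e => HX *ᵥ e) {x | HX *ᵥ x = 0} hammingNorm →
        ∑ e ∈ univ.filter (fun e : Fin n → ZMod 2 =>
            ¬ Dec.Corrects (fun e => HX *ᵥ e) (rowSpace HZ : Set (Fin n → ZMod 2)) e),
            bernoulliWeight p (supp e) ≤ ε := by
  obtain ⟨N, hN⟩ := qldpc_uniform_codeCapacityThreshold hw hδ hp0 hp h4 hε
  obtain ⟨n, hn, mX, mZ, HX, HZ, hcode⟩ := hF (max N N₀)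
  refine ⟨n, (le_max_right _ _).trans hn, mX, mZ, HX, HZ, hcode, fun Dec hDec => ?_⟩
  exact hN mX mZ n HX HZ (R * n) (δ * n) hcode ((le_max_left _ _).trans hn) le_rfl Dec hDec

open Classical in
/-- **Good qLDPC codes have a positive code-capacity threshold, granted the Panteleev–Kalachev existence
theorem** (named fact `PanteleevKalachev2022_good_qldpc`, hypothesis `hPK`): for every rate `R ∈ (0,1)`
there are a locality `w ≥ 2` and a relative distance `c > 0` such that below `p₀(w-1)`
(`4(w-1)² p(1-p) < 1`) the binary family has members of arbitrarily large length `n` with `k ≥ Rn`,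
`d ≥ cn` and `Z`-failure probability `≤ ε` under every minimum-weight decoder, for every `ε > 0`.
CONDITIONAL on `hPK` only. [cite: PanteleevKalachev2022, Theorem 2 (with DumerKovalevPryadko2015 Thm 2)] -/
theorem goodQLDPC_belowThreshold_of_PK (hPK : PanteleevKalachev2022_good_qldpc) {R : ℝ} (hR0 : 0 < R)
    (hR1 : R < 1) :
    ∃ (w : ℕ) (c : ℝ), 2 ≤ w ∧ 0 < c ∧ IsQLDPCFamily (ZMod 2) w R c ∧
      ∀ {p : ℝ}, 0 ≤ p → p ≤ 1 / 2 → 4 * ((w - 1 : ℕ) : ℝ) ^ 2 * (p * (1 - p)) < 1 →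
      ∀ {ε : ℝ}, 0 < ε → ∀ N₀ : ℕ,
        ∃ n : ℕ, N₀ ≤ n ∧ ∃ (mX mZ : ℕ) (HX : Matrix (Fin mX) (Fin n) (ZMod 2))
          (HZ : Matrix (Fin mZ) (Fin n) (ZMod 2)), IsQLDPCCodeWith HX HZ w (R * n) (c * n) ∧
          ∀ (Dec : Decoder (Fin mX → ZMod 2) (Fin n → ZMod 2)),
            Dec.IsMinWeight (fun e => HX *ᵥ e) {x | HX *ᵥ x = 0} hammingNorm →
            ∑ e ∈ univ.filter (fun e : Fin n → ZMod 2 =>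
                ¬ Dec.Corrects (fun e => HX *ᵥ e) (rowSpace HZ : Set (Fin n → ZMod 2)) e),
                bernoulliWeight p (supp e) ≤ ε := by
  obtain ⟨w, c, hc, hF⟩ := hPK (ZMod 2) R hR0 hR1
  have hF' : IsQLDPCFamily (ZMod 2) (max w 2) R c := hF.mono (le_max_left _ _) le_rfl le_rfl
  refine ⟨max w 2, c, le_max_right _ _, hc, hF', ?_⟩
  intro p hp0 hp h4 ε hε N₀
  exact hF'.exists_failureProb_le (le_max_right _ _) hc hp0 hp h4 hε N₀

/-! ### Losses and errors simultaneously -/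

/-- **Finite-size LOSS-AND-ERROR bound for every `w`-limited CSS pair** (erasures `y`, flips `p`, every
minimum-weight-outside-the-erasure decoder): `P_fail ≤ n ((w-1)Υ)^{⌈D⌉} / ((w-1)(1-(w-1)Υ))`.
[cite: DumerKovalevPryadko2015, Thm 2 (full statement) with App. A §1.1] -/
theorem IsQLDPCCodeWith.zMixedFailureProb_le {HX : Matrix RX Q (ZMod 2)} {HZ : Matrix RZ Q (ZMod 2)} {w : ℕ}
    {K D : ℝ} (h : IsQLDPCCodeWith HX HZ w K D) (hw : 2 ≤ w) (hD : 1 ≤ D)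
    {Dec : ErasureDecoder Q (RX → ZMod 2)} (hDec : Dec.IsMinWeightOutside HX)
    {y p : ℝ} (hy0 : 0 ≤ y) (hy1 : y ≤ 1) (hp0 : 0 ≤ p) (hp : p ≤ 1 / 2)
    (hr : ((w - 1 : ℕ) : ℝ) * upsilonCSS y p < 1) :
    mixedFailureProb HX (rowSpace HZ : Set (Q → ZMod 2)) Dec y p ≤
      (Fintype.card Q : ℝ) * (((w - 1 : ℕ) : ℝ) * upsilonCSS y p) ^ ⌈D⌉₊ /
        (((w - 1 : ℕ) : ℝ) * (1 - ((w - 1 : ℕ) : ℝ) * upsilonCSS y p)) := by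
  have hrow : ∀ i, (rowSupp HX i).card ≤ w := fun i => by
    rw [card_rowSupp_eq_hammingNorm]; exact h.rowX_le i
  have hd1 : 1 ≤ ⌈D⌉₊ := Nat.one_le_iff_ne_zero.2 (Nat.pos_iff_ne_zero.1 (Nat.ceil_pos.2 (by linarith)))
  have hd : ∀ x : Q → ZMod 2, HX *ᵥ x = 0 → x ∉ rowSpace HZ → ⌈D⌉₊ ≤ hammingNorm x :=
    fun x hx hxS => Nat.ceil_le.2 (h.le_hammingNorm (Or.inl ⟨hx, hxS⟩))
  exact mixedFailureProb_le HX (rowSpace HZ) hDec hw hrow hd1 hd hy0 hy1 hp0 hp hr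

/-- **Uniform LOSS-AND-ERROR region `(w-1)·Υ_CSS(y,p) < 1` for `w`-limited quantum LDPC codes of relative
distance `≥ δ`**: for every `ε > 0` there is `N` such that every `w`-limited CSS pair of length `n ≥ N` with
`D ≥ δ n`, decoded by ANY minimum-weight-outside-the-erasure decoder, fails with probability `≤ ε`. The axes
`y = 0` / `p = 0` are `qldpc_uniform_codeCapacityThreshold` / `qldpc_uniform_erasureThreshold`.
[cite: DumerKovalevPryadko2015, Thm 2 (full statement, (w−1)Υ_CSS < 1)] -/
theorem qldpc_uniform_mixedThreshold {w : ℕ} (hw : 2 ≤ w) {δ : ℝ} (hδ : 0 < δ)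
    {y p : ℝ} (hy0 : 0 ≤ y) (hy1 : y ≤ 1) (hp0 : 0 ≤ p) (hp : p ≤ 1 / 2)
    (hΥ : ((w - 1 : ℕ) : ℝ) * upsilonCSS y p < 1) {ε : ℝ} (hε : 0 < ε) :
    ∃ N : ℕ, ∀ (mX mZ n : ℕ) (HX : Matrix (Fin mX) (Fin n) (ZMod 2)) (HZ : Matrix (Fin mZ) (Fin n) (ZMod 2))
      (K D : ℝ), IsQLDPCCodeWith HX HZ w K D → N ≤ n → δ * n ≤ D →
      ∀ Dec : ErasureDecoder (Fin n) (Fin mX → ZMod 2), Dec.IsMinWeightOutside HX →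
        mixedFailureProb HX (rowSpace HZ : Set (Fin n → ZMod 2)) Dec y p ≤ ε := by
  set Kw : ℝ := ((w - 1 : ℕ) : ℝ) with hKw
  have hK1 : 1 ≤ Kw := by
    rw [hKw]
    exact_mod_cast (show 1 ≤ w - 1 by omega)
  have hK0 : 0 < Kw := by linarith
  have hΥ0 : 0 ≤ upsilonCSS y p := by
    unfold upsilonCSS
    have := Real.sqrt_nonneg (p * (1 - p))
    nlinarith
  set r : ℝ := Kw * upsilonCSS y p with hrdef
  have hr0 : 0 ≤ r := by positivity
  have hr1 : r < 1 := hΥ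
  have h1r : 0 < 1 - r := by linarith
  obtain ⟨M, hM⟩ := exists_forall_ge_mul_pow_le (δ * (Kw * (1 - r))) hr0 hr1 hε
  obtain ⟨N, hN⟩ := exists_nat_ge ((max (M : ℝ) 1) / δ)
  refine ⟨N, fun mX mZ n HX HZ K D hcode hn hDn Dec hDec => ?_⟩
  have hδn : max (M : ℝ) 1 ≤ δ * n := by
    have h1 : (max (M : ℝ) 1) / δ ≤ n := hN.trans (by exact_mod_cast hn)
    rwa [div_le_iff₀ hδ, mul_comm] at h1
  have hD1 : 1 ≤ D := le_trans (le_trans (le_max_right _ _) hδn) hDn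
  have hDM : (M : ℝ) ≤ D := le_trans (le_trans (le_max_left _ _) hδn) hDn
  have hceil : M ≤ ⌈D⌉₊ := by
    have : (M : ℝ) ≤ ⌈D⌉₊ := hDM.trans (Nat.le_ceil D)
    exact_mod_cast this
  have hfin := hcode.zMixedFailureProb_le hw hD1 hDec hy0 hy1 hp0 hp (by rw [← hKw]; exact hr1)
  rw [Fintype.card_fin, ← hKw] at hfin
  refine hfin.trans ?_
  have hnD : (n : ℝ) ≤ ⌈D⌉₊ / δ := by
    rw [le_div_iff₀ hδ, mul_comm]
    exact hDn.trans (Nat.le_ceil D)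
  have hc : 0 < δ * (Kw * (1 - r)) := by positivity
  have hrm : 0 ≤ r ^ ⌈D⌉₊ := pow_nonneg hr0 _
  have hstep : (n : ℝ) * r ^ ⌈D⌉₊ / (Kw * (1 - r)) ≤ (⌈D⌉₊ : ℝ) * r ^ ⌈D⌉₊ / (δ * (Kw * (1 - r))) := by
    rw [div_le_div_iff₀ (by positivity) hc]
    have : (n : ℝ) * (δ * (Kw * (1 - r))) ≤ (⌈D⌉₊ : ℝ) * (Kw * (1 - r)) := by
      have h1 : (n : ℝ) * δ ≤ ⌈D⌉₊ := by
        have := hnD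
        rwa [le_div_iff₀ hδ] at this
      nlinarith
    nlinarith
  have hfold : Kw * upsilonCSS y p = r := rfl
  rw [hfold]
  exact hstep.trans (hM _ hceil)

omit [Fintype RX] in
/-- Non-vacuity of the decoder class for every pair. [cite: DumerKovalevPryadko2015, p. 3 (exhaustive search decoder)] -/
theorem qldpc_minWeightOutside_isMinWeightOutside (HX : Matrix RX Q (ZMod 2)) :
    (ErasureDecoder.minWeightOutside HX).IsMinWeightOutside HX :=
  ErasureDecoder.minWeightOutside_isMinWeightOutside HX

end Literature.InformationTheory.QuantumCodes
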